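import Summits.BirchSwinnertonDyer.BirchSwinnertonDyer.Theorems.ClassRecordThreeEulerHalvesAtThreeHybridInertSavingAnchor
import Summits.BirchSwinnertonDyer.BirchSwinnertonDyer.Theorems.ErratumRoadFiveEulerHalfJetchevAtPDefect
import HarnessLib

/-!
# Route `ClassRecordThree` (rung K2@3), crux 5 `EulerHalvesAtThree` (item stmt-BirchSwinnertonDyer-19109, shared by
# `KolyvaginRoadThree`): the POSITIVE NORMAL FORM of the line's IMC-grade residual after the `3`-anchor — «two additive `3`-carriers, OR
# exactly one additive `3`-carrier beside an EVEN number of multiplicative primes `≠ 3`, all of them split carriers»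
# (cell `bsd-stepL`, seat `bsd-stepL-tam3-p1` g17, owner of the line; `--supports stmt-BirchSwinnertonDyer-19109 --as helper`)

WHY. After r15 (`…NotRamInertServableCutAnchorDF`, p633307) the IMC-grade stub `stub_coStepLResidualShapeAtThree` is asked on a multi-carrier surj
X11b@3 curve `W` under «(¬(ram) ∧ NOT datum-free-inert-admissible ∧ NOT datum-free-admissible-up-to-one) ∨ (two distinct non-split `3`-carrier
primes `≠ 3`)» — two NEGATED existential predicates on the ¬(ram) side. This file turns the hypothesis into a DECIDABLE POSITIVE description of the
residual population, by elementary bookkeeping over the reduction types (no new input):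

* §0 `padicValNat_tamagawaProduct_le_of_carriers_only_three` — if no prime `q ≠ 3` has `3 ∣ c_q(E)` then `ord₃ ∏_ℓ c_ℓ(E) ≤ ord₃ c₃(E)` (the curve is
  MONO-carrier; the Tamagawa product is the finite product of the local factors, `tamagawaProduct_eq_prod`).
* §1 `residualNormalForm_of_notRam_of_not_admissibleDF` — X11b@3, ¬(ram), multi-carrier, NOT datum-free-inert-admissible, NOT datum-free-admissible-up-
  to-one ⟹ EITHER two distinct non-split `3`-carrier primes `≠ 3`, OR exactly one non-split `3`-carrier prime `q₁ ≠ 3` while every multiplicative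
  prime `ℓ ≠ 3` is split with `3 ∣ ord_ℓ Δ_min` and the set `B` of these has EVEN cardinality. (Under ¬(ram) every split multiplicative `ℓ ≠ 3`
  is a carrier; the free members of an inert set are the non-split multiplicative primes `≠ 3`; parity does the rest; the case «no carrier `≠ 3` at
  all» is excluded by §0 and the multi-carrier hypothesis.)
* §2 `residualNormalForm_of_residualAnchor` — the r15 hypothesis (either disjunct) ⟹ the normal form; the (ram) disjunct is its first alternative.
So the honest IMC-grade residual of 19109's line reads, positively: **surj multi-carrier X11b@3 curves with (a) two additive places of Kodaira type
IV ∕ IV* with `c = 3`, or (b) exactly one such place, no (ram) prime, and an even number of multiplicative primes `≠ 3`, all split with `3 ∣ c`**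
(g14 window census: 206 curves = these two families; (b) ⊇ the 102 «Mult(E) = {3}» curves). r16 of `Lines/inert.lean` states the stub this way.

HONEST FRAMING: THEOREMS ONLY (no definition, no named fact, no `sorry`); elementary; nothing booked; no census label moves (T7); item 19109 is NOT
closed; the IMC-grade input itself is untouched. BSD is not proved by any of this.
References: [SilvermanATAEC1994] IV.9.4, Cor. IV.9.2(d) (Kodaira–Néron: `c_q ∈ {1,2,3,4}` at additive places, `c_q = ord_q Δ_min` at split ones);
[PastenShimura2024] §6 (the inert-set bookkeeping these predicates come from).
presearch: not applicable (bookkeeping over tree theorems); `lean search 'residualNormalForm'` → none.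
Axioms: `propext`, `Classical.choice`, `Quot.sound`.
-/

noncomputable section

open scoped Classical NumberField

namespace Summit.BirchSwinnertonDyer.Rank1Residual.X11b.Three.Koly

open WeierstrassCurve NumberField IsDedekindDomain Field Literature.NumberTheory.EllipticCurves
  Literature.NumberTheory.EllipticCurves.ModularForms Literature.NumberTheory.GaloisCohomology
  Literature.NumberTheory.EllipticCurves.Rank1Residual Literature.NumberTheory.EllipticCurves.Rank1Residual.Typed
  Literature.NumberTheory.QuadraticFields.Quadratic Literature.NumberTheory.EllipticCurves.BarriosEtAl2025
  Literature.NumberTheory.Automorphic CongruenceSubgroup Rat.HeightOneSpectrum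
  Summit.BirchSwinnertonDyer.Rank1Residual Summit.BirchSwinnertonDyer.Rank1Residual.X11b
  Summit.BirchSwinnertonDyer.Rank1Residual.X11b.AcSelmer
  Summit.BirchSwinnertonDyer.BirchSwinnertonDyer.Theorems

/-! ### §0 No carrier off `3` ⟹ mono-carrier -/

/-- `ord_p` of a finite product of non-zero naturals is the sum of the `ord_p`. [folklore] -/
private theorem padicValNat_finset_prod' (p : ℕ) [Fact p.Prime] {ι : Type*} (s : Finset ι)
    (f : ι → ℕ) (hf : ∀ i ∈ s, f i ≠ 0) :
    padicValNat p (∏ i ∈ s, f i) = ∑ i ∈ s, padicValNat p (f i) := by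
  induction s using Finset.induction_on with
  | empty => simp
  | insert a s ha ih =>
    rw [Finset.prod_insert ha, Finset.sum_insert ha,
      padicValNat.mul (hf a (Finset.mem_insert_self a s))
        (Finset.prod_ne_zero_iff.mpr fun i hi => hf i (Finset.mem_insert_of_mem hi)),
      ih fun i hi => hf i (Finset.mem_insert_of_mem hi)]

/-- **`ord₃ ∏_ℓ c_ℓ(E) ≤ ord₃ c₃(E)` when no prime `q ≠ 3` carries: `3 ∤ c_q(E)` for every `q ≠ 3`.** The Tamagawa product is the finite
product of the local factors over the bad places (`tamagawaProduct_eq_prod`); only the place `3` contributes to `ord₃`.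
[cite: SilvermanAEC2009, Thm VII.6.1] -/
theorem padicValNat_tamagawaProduct_le_of_carriers_only_three
    (W : WeierstrassCurve ℚ) [W.IsElliptic] [W.IsGloballyMinimal]
    (hothers : ∀ (q : ℕ) [Fact q.Prime], q ≠ 3 → ¬ 3 ∣ (W.baseChange ℚ_[q]).localTamagawaNumber ℤ_[q]) :
    padicValNat 3 W.tamagawaProduct ≤ padicValNat 3 ((W.baseChange ℚ_[3]).localTamagawaNumber ℤ_[3]) := by
  haveI : Fact (Nat.Prime 3) := ⟨Nat.prime_three⟩
  have hfW : (W.badPlaces ℤ).Finite := W.finite_badPlaces_holds ℤ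
  set s : Finset (HeightOneSpectrum ℤ) := hfW.toFinset with hs
  have hsW : ∀ v, ¬ W.HasGoodReductionAt v → v ∈ s := fun v hv ↦ by
    rw [hs, Set.Finite.mem_toFinset, mem_badPlaces_iff]; exact hv
  set f : HeightOneSpectrum ℤ → ℕ := fun v ↦
    haveI := Fact.mk (primesEquiv v).2
    padicValNat 3 ((W.baseChange ℚ_[primesEquiv v]).localTamagawaNumber ℤ_[primesEquiv v]) with hf
  -- termwise: only the place over `3` can contribute
  have hterm : ∀ v : HeightOneSpectrum ℤ,
      f v ≤ if (primesEquiv v : ℕ) = 3 then padicValNat 3 ((W.baseChange ℚ_[3]).localTamagawaNumber ℤ_[3]) else 0 := by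
    intro v
    haveI := Fact.mk (primesEquiv v).2
    have key : ∀ (q : ℕ) (hq : Fact q.Prime), (primesEquiv v : ℕ) = q →
        padicValNat 3 (@WeierstrassCurve.localTamagawaNumber ℤ_[q] _ _ _ ℚ_[q] _ _ _ (W.baseChange ℚ_[q])) ≤
          if q = 3 then padicValNat 3 ((W.baseChange ℚ_[3]).localTamagawaNumber ℤ_[3]) else 0 := by
      rintro q hq hvq
      by_cases hq3 : q = 3
      · subst hq3
        simp
      · rw [if_neg hq3, Nat.le_zero]
        exact padicValNat.eq_zero_of_not_dvd (hothers q hq3)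
    exact key _ _ rfl
  rw [tamagawaProduct_eq_prod W s hsW, padicValNat_finset_prod' 3 s _ fun v _ ↦ ?_]
  · calc ∑ v ∈ s, f v
        ≤ ∑ v ∈ s, (if (primesEquiv v : ℕ) = 3 then
            padicValNat 3 ((W.baseChange ℚ_[3]).localTamagawaNumber ℤ_[3]) else 0) :=
          Finset.sum_le_sum fun v _ ↦ hterm v
      _ = ∑ ℓ ∈ s.image (fun v ↦ (primesEquiv v : ℕ)),
            (if ℓ = 3 then padicValNat 3 ((W.baseChange ℚ_[3]).localTamagawaNumber ℤ_[3]) else 0) := by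
          rw [Finset.sum_image]
          intro v _ w _ h
          exact primesEquiv.injective (Subtype.ext h)
      _ ≤ padicValNat 3 ((W.baseChange ℚ_[3]).localTamagawaNumber ℤ_[3]) := by
          rw [Finset.sum_ite_eq']
          split_ifs <;> simp
  · haveI := Fact.mk (primesEquiv v).2
    haveI : (W.baseChange ℚ_[primesEquiv v]).IsElliptic :=
      inferInstanceAs (W.map (algebraMap ℚ ℚ_[primesEquiv v])).IsElliptic
    exact localTamagawaNumber_padic_ne_zero_holds (primesEquiv v) _

/-- **No carrier off `3` contradicts «multi-carrier»** (`∀ v, ord₃ c_v(E) < ord₃ ∏ c`): at the place `v₃` over `3` §0 gives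
`ord₃ ∏ c ≤ ord₃ c₃ = ord₃ c_{v₃}`. [cite: SilvermanAEC2009, Thm VII.6.1] -/
theorem not_multi_of_carriers_only_three
    (W : WeierstrassCurve ℚ) [W.IsElliptic] [W.IsGloballyMinimal]
    (hothers : ∀ (q : ℕ) [Fact q.Prime], q ≠ 3 → ¬ 3 ∣ (W.baseChange ℚ_[q]).localTamagawaNumber ℤ_[q])
    (hmulti : ∀ v : HeightOneSpectrum (𝓞 ℚ), padicValNat 3 (W.tamagawaNumberAt v) < padicValNat 3 W.tamagawaProduct) :
    False := by
  haveI : Fact (Nat.Prime 3) := ⟨Nat.prime_three⟩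
  set v : HeightOneSpectrum (𝓞 ℚ) := (Rat.HeightOneSpectrum.primesEquiv (R := 𝓞 ℚ)).symm ⟨3, Nat.prime_three⟩ with hvdef
  have hv : (Rat.HeightOneSpectrum.primesEquiv v : ℕ) = 3 := by
    rw [hvdef, Equiv.apply_symm_apply]
  have h := hmulti v
  rw [tamagawaNumberAt_def, ← WeierstrassCurve.localTamagawaNumber_padic_eq_holds W v 3 hv] at h
  exact absurd (padicValNat_tamagawaProduct_le_of_carriers_only_three W hothers) (not_le.mpr h)

/-! ### §1 The ¬(ram) disjunct in positive normal form -/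

/-- **POSITIVE NORMAL FORM of the ¬(ram) residual.** Let `W` be X11b@3 with NO (ram) prime (every multiplicative `ℓ ≠ 3` has `3 ∣ ord_ℓ Δ_min`),
multi-carrier, and assume `W` is NEITHER datum-free inert-admissible («every `3`-carrier split ∧ an even multiplicative `S ∋ 3` with every
split-carrier `ℓ ∉ S` excluded») NOR datum-free admissible up to one exempted bad place. Then EITHER `W` has two distinct non-split `3`-carrier
primes `≠ 3`, OR it has exactly one, `q₁`, while every multiplicative `ℓ ≠ 3` is split with `3 ∣ ord_ℓ Δ_min` and the set `B` of these has EVEN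
cardinality. Bookkeeping: under ¬(ram) the split multiplicative primes `≠ 3` are exactly the split carriers `B`, the optional members of an inert
set are the non-split multiplicative primes `≠ 3`; with one non-split carrier exempted the set `{3} ∪ B (∪ {t})` is admissible unless `#B` is
even and no `t` exists; with none, `{3} ∪ B (∪ {t})` or `{3} ∪ (B ∖ {b})` with `b` exempted is admissible unless `B = ∅` and no `t` exists —
and then no prime `≠ 3` carries, contradicting multi-carrier (§0). [folklore] [cite: SilvermanATAEC1994, IV.9.4 and Cor. IV.9.2(d)] -/
theorem residualNormalForm_of_notRam_of_not_admissibleDF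
    (W : WeierstrassCurve ℚ) [W.IsElliptic] [W.IsGloballyMinimal] (hX : ClassX11b W 3) (hnram : ¬ Ram W 3)
    (hmulti : ∀ v : HeightOneSpectrum (𝓞 ℚ), padicValNat 3 (W.tamagawaNumberAt v) < padicValNat 3 W.tamagawaProduct)
    (hadm₀ : ¬ ((∀ (q : ℕ) [Fact q.Prime], 3 ∣ (W.baseChange ℚ_[q]).localTamagawaNumber ℤ_[q] →
          W.HasSplitMultiplicativeReductionAtPrime q) ∧
        ∃ S : Finset ℕ, (∀ ℓ ∈ S, ∃ _ : Fact ℓ.Prime, Mult W ℓ) ∧ Even S.card ∧ 3 ∈ S ∧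
          (∀ (ℓ : ℕ) [Fact ℓ.Prime], ℓ ∉ S → W.HasSplitMultiplicativeReductionAtPrime ℓ →
            ¬ 3 ∣ padicValInt ℓ W.minimalDiscriminantInt)))
    (hadm₁ : ¬ (∃ (q₁ : ℕ) (_ : Fact q₁.Prime), ¬ W.HasGoodReductionAtPrime q₁ ∧
        (∀ (q : ℕ) [Fact q.Prime], q ≠ q₁ → 3 ∣ (W.baseChange ℚ_[q]).localTamagawaNumber ℤ_[q] →
          W.HasSplitMultiplicativeReductionAtPrime q) ∧
        ∃ S : Finset ℕ, (∀ ℓ ∈ S, ∃ _ : Fact ℓ.Prime, Mult W ℓ) ∧ Even S.card ∧ 3 ∈ S ∧ q₁ ∉ S ∧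
          (∀ (ℓ : ℕ) [Fact ℓ.Prime], ℓ ∉ S → ℓ ≠ q₁ → W.HasSplitMultiplicativeReductionAtPrime ℓ →
            ¬ 3 ∣ padicValInt ℓ W.minimalDiscriminantInt))) :
    (∃ (q₀ : ℕ) (_ : Fact q₀.Prime), q₀ ≠ 3 ∧ 3 ∣ (W.baseChange ℚ_[q₀]).localTamagawaNumber ℤ_[q₀] ∧
        ¬ W.HasSplitMultiplicativeReductionAtPrime q₀ ∧
        ∃ (q₀' : ℕ) (_ : Fact q₀'.Prime), q₀' ≠ 3 ∧ q₀' ≠ q₀ ∧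
          3 ∣ (W.baseChange ℚ_[q₀']).localTamagawaNumber ℤ_[q₀'] ∧ ¬ W.HasSplitMultiplicativeReductionAtPrime q₀') ∨
      ∃ (q₁ : ℕ) (_ : Fact q₁.Prime), q₁ ≠ 3 ∧ 3 ∣ (W.baseChange ℚ_[q₁]).localTamagawaNumber ℤ_[q₁] ∧
        ¬ W.HasSplitMultiplicativeReductionAtPrime q₁ ∧
        (∀ (q : ℕ) [Fact q.Prime], q ≠ 3 → q ≠ q₁ → 3 ∣ (W.baseChange ℚ_[q]).localTamagawaNumber ℤ_[q] →
          W.HasSplitMultiplicativeReductionAtPrime q) ∧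
        (∀ (ℓ : ℕ) [Fact ℓ.Prime], ℓ ≠ 3 → Mult W ℓ →
          W.HasSplitMultiplicativeReductionAtPrime ℓ ∧ 3 ∣ padicValInt ℓ W.minimalDiscriminantInt) ∧
        ∃ B : Finset ℕ, (∀ q : ℕ, q ∈ B ↔ ∃ _ : Fact q.Prime, q ≠ 3 ∧ W.HasSplitMultiplicativeReductionAtPrime q ∧
            3 ∣ padicValInt q W.minimalDiscriminantInt) ∧ Even B.card := by
  obtain ⟨-, -, hmult3, -⟩ := id hX
  obtain ⟨B, hB⟩ := exists_finset_splitCarriers W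
  have h3B : 3 ∉ B := fun h ↦ by obtain ⟨_, h3, -⟩ := (hB 3).mp h; exact h3 rfl
  -- members of `B` are multiplicative
  have hBmult : ∀ ℓ ∈ B, ∃ _ : Fact ℓ.Prime, Mult W ℓ := fun ℓ hℓ ↦ by
    obtain ⟨hF, -, hs, -⟩ := (hB ℓ).mp hℓ; exact ⟨hF, hs.hasMultiplicativeReductionAtPrime⟩
  -- under ¬(ram), every split multiplicative `ℓ ≠ 3` lies in `B`
  have hsplitB : ∀ (ℓ : ℕ) [Fact ℓ.Prime], ℓ ≠ 3 → W.HasSplitMultiplicativeReductionAtPrime ℓ → ℓ ∈ B := by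
    intro ℓ hℓF hℓ3 hs
    refine (hB ℓ).mpr ⟨hℓF, hℓ3, hs, ?_⟩
    by_contra hv
    exact hnram ⟨ℓ, hℓF, hℓ3, hs.hasMultiplicativeReductionAtPrime, hv⟩
  -- the carrier at `3` (if any) is split
  have hsplit3 : 3 ∣ (W.baseChange ℚ_[3]).localTamagawaNumber ℤ_[3] → W.HasSplitMultiplicativeReductionAtPrime 3 :=
    fun h3 ↦ (split_and_three_dvd_of_mult_of_three_dvd_localTamagawaNumber W 3 hmult3 h3).1
  -- an admissible inert set from `B` and an optional NON-SPLIT multiplicative prime `t ∉ B ∪ {3}` (or none), of either parity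
  -- (i) `S = {3} ∪ B` when `#B` is odd
  have hS_odd : Odd B.card → (∀ ℓ ∈ insert 3 B, ∃ _ : Fact ℓ.Prime, Mult W ℓ) ∧ Even (insert 3 B).card ∧ 3 ∈ insert 3 B ∧
      (∀ (ℓ : ℕ) [Fact ℓ.Prime], ℓ ∉ insert 3 B → W.HasSplitMultiplicativeReductionAtPrime ℓ →
        ¬ 3 ∣ padicValInt ℓ W.minimalDiscriminantInt) := by
    intro hodd
    refine ⟨?_, ?_, by simp, ?_⟩
    · intro ℓ hℓ
      rcases Finset.mem_insert.mp hℓ with rfl | hℓ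
      · exact ⟨⟨Nat.prime_three⟩, hmult3⟩
      · exact hBmult ℓ hℓ
    · rw [Finset.card_insert_of_notMem h3B]
      obtain ⟨r, hr⟩ := hodd
      exact ⟨r + 1, by omega⟩
    · intro ℓ _ hℓS hs _
      have hℓ3 : ℓ ≠ 3 := fun h ↦ hℓS (by simp [h])
      exact hℓS (Finset.mem_insert_of_mem (hsplitB ℓ hℓ3 hs))
  -- (ii) `S = {3, t} ∪ B` when `#B` is even and `t ≠ 3` is a NON-SPLIT multiplicative prime
  have hS_even : ∀ (t : ℕ) [Fact t.Prime], t ≠ 3 → Mult W t → ¬ W.HasSplitMultiplicativeReductionAtPrime t → Even B.card →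
      (∀ ℓ ∈ insert 3 (insert t B), ∃ _ : Fact ℓ.Prime, Mult W ℓ) ∧ Even (insert 3 (insert t B)).card ∧
      3 ∈ insert 3 (insert t B) ∧ t ∈ insert 3 (insert t B) ∧
      (∀ (ℓ : ℕ) [Fact ℓ.Prime], ℓ ∉ insert 3 (insert t B) → W.HasSplitMultiplicativeReductionAtPrime ℓ →
        ¬ 3 ∣ padicValInt ℓ W.minimalDiscriminantInt) := by
    intro t htF ht3 hmt hts heven
    have htB : t ∉ B := fun h ↦ by obtain ⟨_, -, hs, -⟩ := (hB t).mp h; exact hts hs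
    have h3S' : (3 : ℕ) ∉ insert t B := by
      rw [Finset.mem_insert, not_or]; exact ⟨Ne.symm ht3, h3B⟩
    refine ⟨?_, ?_, by simp, by simp, ?_⟩
    · intro ℓ hℓ
      rcases Finset.mem_insert.mp hℓ with rfl | hℓ
      · exact ⟨⟨Nat.prime_three⟩, hmult3⟩
      · rcases Finset.mem_insert.mp hℓ with rfl | hℓ
        · exact ⟨htF, hmt⟩
        · exact hBmult ℓ hℓ
    · rw [Finset.card_insert_of_notMem h3S', Finset.card_insert_of_notMem htB]
      obtain ⟨r, hr⟩ := heven
      exact ⟨r + 1, by omega⟩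
    · intro ℓ _ hℓS hs _
      have hℓ3 : ℓ ≠ 3 := fun h ↦ hℓS (by simp [h])
      exact hℓS (Finset.mem_insert_of_mem (Finset.mem_insert_of_mem (hsplitB ℓ hℓ3 hs)))
  -- a non-split `3`-carrier `q ≠ 3` is a bad prime
  have hbad_of_carrier : ∀ (q : ℕ) [Fact q.Prime], 3 ∣ (W.baseChange ℚ_[q]).localTamagawaNumber ℤ_[q] →
      ¬ W.HasGoodReductionAtPrime q := by
    intro q _ hc hgood
    haveI : (W.baseChange ℚ_[q]).IsElliptic := inferInstanceAs (W.map (algebraMap ℚ ℚ_[q])).IsElliptic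
    have hc1 : (W.baseChange ℚ_[q]).localTamagawaNumber ℤ_[q] = 1 := by
      haveI : ((W.baseChange ℚ_[q]).minimal ℤ_[q]).HasGoodReduction ℤ_[q] := hgood
      exact localTamagawaNumber_eq_one_of_hasGoodReduction_holds ℤ_[q] _
    rw [hc1] at hc
    exact absurd (Nat.le_of_dvd one_pos hc) (by decide)
  by_cases hΓ : ∀ (q : ℕ) [Fact q.Prime], q ≠ 3 → 3 ∣ (W.baseChange ℚ_[q]).localTamagawaNumber ℤ_[q] →
      W.HasSplitMultiplicativeReductionAtPrime q
  · -- no non-split carrier `≠ 3`: every carrier is split (the SHAPE); the admissible sets of (i)/(ii), or `B ∖ {b}` with `b` exempted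
    exfalso
    have hshape : ∀ (q : ℕ) [Fact q.Prime], 3 ∣ (W.baseChange ℚ_[q]).localTamagawaNumber ℤ_[q] →
        W.HasSplitMultiplicativeReductionAtPrime q := by
      intro q _ h3
      by_cases hq3 : q = 3
      · subst hq3; exact hsplit3 h3
      · exact hΓ q hq3 h3
    rcases Nat.even_or_odd B.card with heven | hodd
    · by_cases hNS : ∃ (t : ℕ) (_ : Fact t.Prime), t ≠ 3 ∧ Mult W t ∧ ¬ W.HasSplitMultiplicativeReductionAtPrime t
      · obtain ⟨t, htF, ht3, hmt, hts⟩ := hNS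
        haveI := htF
        obtain ⟨hSm, hSe, h3S, -, hFC⟩ := hS_even t ht3 hmt hts heven
        exact hadm₀ ⟨hshape, insert 3 (insert t B), hSm, hSe, h3S, hFC⟩
      · by_cases hBne : B.Nonempty
        · -- exempt one split carrier `b`: `S = {3} ∪ (B ∖ {b})`
          obtain ⟨b, hb⟩ := hBne
          obtain ⟨hbF, hb3, hbs, hbv⟩ := (hB b).mp hb
          haveI := hbF
          have hbc : 3 ∣ (W.baseChange ℚ_[b]).localTamagawaNumber ℤ_[b] :=
            three_dvd_localTamagawaNumber_of_split_of_three_dvd W b hbs hbv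
          have h3B' : (3 : ℕ) ∉ B.erase b := fun h ↦ h3B (Finset.mem_of_mem_erase h)
          refine hadm₁ ⟨b, hbF, hbad_of_carrier b hbc, fun q _ _ h3 ↦ hshape q h3, insert 3 (B.erase b), ?_, ?_, by simp, ?_, ?_⟩
          · intro ℓ hℓ
            rcases Finset.mem_insert.mp hℓ with rfl | hℓ
            · exact ⟨⟨Nat.prime_three⟩, hmult3⟩
            · exact hBmult ℓ (Finset.mem_of_mem_erase hℓ)
          · rw [Finset.card_insert_of_notMem h3B', Finset.card_erase_of_mem hb]
            obtain ⟨r, hr⟩ := heven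
            have hpos : 0 < B.card := Finset.card_pos.mpr ⟨b, hb⟩
            exact ⟨r, by omega⟩
          · simp only [Finset.mem_insert, Finset.mem_erase, ne_eq, not_true_eq_false, false_and, not_or, not_false_eq_true,
              and_true]
            exact hb3
          · intro ℓ _ hℓS hℓb hs _
            have hℓ3 : ℓ ≠ 3 := fun h ↦ hℓS (by simp [h])
            exact hℓS (Finset.mem_insert_of_mem (Finset.mem_erase.mpr ⟨hℓb, hsplitB ℓ hℓ3 hs⟩))
        · -- `B = ∅` and no non-split multiplicative prime `≠ 3`: no carrier off `3` at all — contradicts multi-carrier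
          have hB0 : B = ∅ := Finset.not_nonempty_iff_eq_empty.mp hBne
          refine not_multi_of_carriers_only_three W (fun q hqF hq3 hc ↦ ?_) hmulti
          have hs : W.HasSplitMultiplicativeReductionAtPrime q := hΓ q hq3 hc
          have hqB : q ∈ B := hsplitB q hq3 hs
          rw [hB0] at hqB
          exact Finset.notMem_empty q hqB
    · obtain ⟨hSm, hSe, h3S, hFC⟩ := hS_odd hodd
      exact hadm₀ ⟨hshape, insert 3 B, hSm, hSe, h3S, hFC⟩
  · -- a non-split carrier `g ≠ 3`
    push Not at hΓ
    obtain ⟨g, hgF, hg3, hcg, hgs⟩ := hΓ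
    haveI := hgF
    by_cases h2 : ∃ (q₀' : ℕ) (_ : Fact q₀'.Prime), q₀' ≠ 3 ∧ q₀' ≠ g ∧
        3 ∣ (W.baseChange ℚ_[q₀']).localTamagawaNumber ℤ_[q₀'] ∧ ¬ W.HasSplitMultiplicativeReductionAtPrime q₀'
    · exact Or.inl ⟨g, hgF, hg3, hcg, hgs, h2⟩
    · -- `g` is the ONLY non-split carrier `≠ 3`
      have huniq : ∀ (q : ℕ) [Fact q.Prime], q ≠ 3 → q ≠ g →
          3 ∣ (W.baseChange ℚ_[q]).localTamagawaNumber ℤ_[q] → W.HasSplitMultiplicativeReductionAtPrime q := by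
        intro q _ hq3 hqg h3
        by_contra hs
        exact h2 ⟨q, ‹_›, hq3, hqg, h3, hs⟩
      have hshape : ∀ (q : ℕ) [Fact q.Prime], q ≠ g → 3 ∣ (W.baseChange ℚ_[q]).localTamagawaNumber ℤ_[q] →
          W.HasSplitMultiplicativeReductionAtPrime q := by
        intro q _ hqg h3
        by_cases hq3 : q = 3
        · subst hq3; exact hsplit3 h3
        · exact huniq q hq3 hqg h3
      have hgB : g ∉ B := fun h ↦ by obtain ⟨_, -, hs, -⟩ := (hB g).mp h; exact hgs hs
      have hgbad : ¬ W.HasGoodReductionAtPrime g := hbad_of_carrier g hcg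
      -- `g` is additive (a multiplicative `3`-carrier is split), so it is never a member of an inert set
      have hgnm : ¬ Mult W g := fun hm ↦ hgs (split_and_three_dvd_of_mult_of_three_dvd_localTamagawaNumber W g hm hcg).1
      -- every multiplicative `ℓ ≠ 3` is split (else (i)/(ii) with `g` exempted), hence a split carrier
      have hNS : ∀ (t : ℕ) [Fact t.Prime], t ≠ 3 → Mult W t → W.HasSplitMultiplicativeReductionAtPrime t := by
        intro t htF ht3 hmt
        by_contra hts
        rcases Nat.even_or_odd B.card with heven | hodd
        · obtain ⟨hSm, hSe, h3S, htS, hFC⟩ := hS_even t ht3 hmt hts heven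
          have hgS : g ∉ insert 3 (insert t B) := by
            intro h
            rcases Finset.mem_insert.mp h with h | h
            · exact hg3 h
            · rcases Finset.mem_insert.mp h with h | h
              · exact hgnm (h ▸ hmt)
              · exact hgB h
          exact hadm₁ ⟨g, hgF, hgbad, fun q _ hqg h3 ↦ hshape q hqg h3, insert 3 (insert t B), hSm, hSe, h3S, hgS,
            fun ℓ _ hℓS _ hs hv ↦ hFC ℓ hℓS hs hv⟩
        · obtain ⟨hSm, hSe, h3S, hFC⟩ := hS_odd hodd
          have hgS : g ∉ insert 3 B := by
            intro h
            rcases Finset.mem_insert.mp h with h | h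
            · exact hg3 h
            · exact hgB h
          exact hadm₁ ⟨g, hgF, hgbad, fun q _ hqg h3 ↦ hshape q hqg h3, insert 3 B, hSm, hSe, h3S, hgS,
            fun ℓ _ hℓS _ hs hv ↦ hFC ℓ hℓS hs hv⟩
      have hallB : ∀ (ℓ : ℕ) [Fact ℓ.Prime], ℓ ≠ 3 → Mult W ℓ →
          W.HasSplitMultiplicativeReductionAtPrime ℓ ∧ 3 ∣ padicValInt ℓ W.minimalDiscriminantInt := by
        intro ℓ _ hℓ3 hm
        have hs := hNS ℓ hℓ3 hm
        obtain ⟨_, -, -, hv⟩ := (hB ℓ).mp (hsplitB ℓ hℓ3 hs)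
        exact ⟨hs, hv⟩
      -- parity: `#B` odd would make `{3} ∪ B` admissible with `g` exempted
      rcases Nat.even_or_odd B.card with heven | hodd
      · exact Or.inr ⟨g, hgF, hg3, hcg, hgs, huniq, hallB, B, hB, heven⟩
      · exfalso
        obtain ⟨hSm, hSe, h3S, hFC⟩ := hS_odd hodd
        have hgS : g ∉ insert 3 B := by
          intro h
          rcases Finset.mem_insert.mp h with h | h
          · exact hg3 h
          · exact hgB h
        exact hadm₁ ⟨g, hgF, hgbad, fun q _ hqg h3 ↦ hshape q hqg h3, insert 3 B, hSm, hSe, h3S, hgS,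
          fun ℓ _ hℓS _ hs hv ↦ hFC ℓ hℓS hs hv⟩

end Summit.BirchSwinnertonDyer.Rank1Residual.X11b.Three.Koly

end
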